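import Mathlib
import Summits.ValiantsHypothesis.ValiantsHypothesis.Theorems.LiouvilleSarnakLiouvilleCutRankOneScaleWindowEmbedding
import Summits.ValiantsHypothesis.ValiantsHypothesis.Theorems.LiouvilleSarnakAlignedTypeIOfDigitalBilinear

/-!
# Route LiouvilleSarnak — crux `LiouvilleCutRank` (stmt-ValiantsHypothesis-14775): every `W`, for all
# cuts with a long ALIGNED WINDOW

`LiouvilleCutRank` asks, for every `W`, that EVERY balanced cut matrix `M_π(r,c) = λ(N_π(r,c) + 1)`
eventually have rank `≥ W`.  Two kinds of unconditional results are in the tree: the finite rungs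
`W ≤ 32` for ALL cuts (`Theorems/LiouvilleSarnakCutRank{Four,Eight,Sixteen,ThirtyTwo}.lean`, window
certificates), and `AlignedCutRank` — EVERY `W` for the ONE aligned cut (low bits = rows, high bits =
columns; `LiouvilleSarnakAligned.alignedCutRank_proof`, from Coons' non-automaticity of `λ`).  This
file combines the window embedding of line `one_scale`
(`LiouvilleSarnakLiouvilleCutRank.OneScale.rank_inducedCut_le`) with `AlignedCutRank` into an
unconditional statement for EVERY `W` on a large FAMILY of cuts:

* `le_rank_of_alignedWindow`: for every `W` there is `L` such that every cut `π` (any level `n`, no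
  balance needed) whose row/column word contains the factor `R^L C^L` — `L` consecutive row
  positions followed by `L` consecutive column positions — has `rank M_π ≥ W`;
* `le_rank_of_antiAlignedWindow`: the same for the factor `C^L R^L` (transpose);

i.e. `LiouvilleCutRank` holds uniformly on the cuts that are "locally aligned" somewhere.  (A uniformly
random balanced cut of length `2n` contains `R^L C^L` with probability `→ 1`, so for each `W` the
exceptional cuts have density `→ 0`; the cuts avoiding both `R^L C^L` and `C^L R^L`, e.g. words built
from blocks `R^a C^b` with `min(a,b) < L`, are exactly where the crux remains open beyond `W = 32`.)

Ingredients: §1 the induced cut of an `R^L C^L` window is the aligned cut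
`π_L = finSumFinEquiv.trans (finCongr (two_mul L).symm)`, whose matrix is the aligned matrix
`(λ(a + 2^L b + 1))_{a,b<2^L}` re-indexed by the bijection `r ↦ ofBits r`
(`CharactersModTwoN.ofBits_alignedCut`, `ofBits_injective_boolVec`), so the ranks agree
(`Matrix.rank_submatrix`); §2 window embedding + `AlignedCutRank`; §3 the anti-aligned window via
`Equiv.sumComm` and `Matrix.rank_transpose`.

Honest framing: a partial, unconditional result toward an OPEN crux (all `W`, structured family of
cuts); `LiouvilleCutRank` for ALL cuts (every `W`), `DigitalBilinearLiouville` and `AlgebraicSarnak`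
stay open, and nothing here bears on VP versus VNP.  No definitions.
-/

-- the directory `ValiantsHypothesis/ValiantsHypothesis` repeats the summit name (tree layout)
set_option linter.dupNamespace false

namespace Summit.ValiantsHypothesis.ValiantsHypothesis.Theorems.LiouvilleSarnakCutRankAlignedWindow

open ArithmeticFunction
open Summit.ValiantsHypothesis.ValiantsHypothesis.Theorems.LiouvilleSarnakLiouvilleCutRank.OneScale
  (rank_inducedCut_le)
open Summit.ValiantsHypothesis.ValiantsHypothesis.Theorems.LiouvilleSarnak.AlignedTypeI.CharactersModTwoN
  (ofBits_alignedCut ofBits_injective_boolVec)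
open Summit.ValiantsHypothesis.ValiantsHypothesis.Theorems.LiouvilleSarnakAligned
  (alignedCutRank_proof)

/-! ### §1 The aligned cut at level `L` and the aligned matrix -/

/-- The aligned cut `π_L = finSumFinEquiv.trans (finCongr (two_mul L).symm)`: position `k < 2L` is a
row position iff `k < L`. [folklore] -/
theorem alignedCut_symm_isLeft (L : ℕ) (k : Fin (2 * L)) :
    ((finSumFinEquiv.trans (finCongr (two_mul L).symm)).symm k).isLeft = decide ((k : ℕ) < L) := by
  set π : Fin L ⊕ Fin L ≃ Fin (2 * L) := finSumFinEquiv.trans (finCongr (two_mul L).symm) with hπ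
  by_cases hk : (k : ℕ) < L
  · have h : π.symm k = Sum.inl ⟨k, hk⟩ := by
      rw [Equiv.symm_apply_eq]
      exact Fin.ext (by simp [hπ, finSumFinEquiv_apply_left])
    rw [h, Sum.isLeft_inl, decide_eq_true hk]
  · have h : π.symm k = Sum.inr ⟨k - L, by omega⟩ := by
      rw [Equiv.symm_apply_eq]
      refine Fin.ext ?_
      have : ((π (Sum.inr ⟨(k : ℕ) - L, by omega⟩) : Fin (2 * L)) : ℕ) = ((k : ℕ) - L) + L := by
        simp [hπ, finSumFinEquiv_apply_right]
      rw [this]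
      omega
    rw [h, Sum.isLeft_inr, decide_eq_false hk]

/-- **The aligned cut matrix has the rank of the aligned matrix.**  At level `L`, the cut matrix of
`π_L` is the aligned matrix `(λ(a + 2^L b + 1))_{a,b<2^L}` re-indexed along the bijection
`r ↦ ofBits r : (Fin L → Bool) ≃ Fin (2^L)`, so the two ranks coincide. [folklore] -/
theorem rank_alignedCut_eq (L : ℕ) :
    (Matrix.of fun r c : Fin L → Bool =>
      (((liouville (Nat.ofBits (fun j : Fin (2 * L) =>
        Sum.elim r c ((finSumFinEquiv.trans (finCongr (two_mul L).symm)).symm j)) + 1) : ℤ) :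
          ℂ))).rank =
    (Matrix.of fun a b : Fin (2 ^ L) =>
      (((liouville ((a : ℕ) + 2 ^ L * (b : ℕ) + 1) : ℤ) : ℂ))).rank := by
  -- the bijection `r ↦ ofBits r`
  have hbij : Function.Bijective
      (fun r : Fin L → Bool => (⟨Nat.ofBits r, Nat.ofBits_lt_two_pow r⟩ : Fin (2 ^ L))) := by
    rw [Fintype.bijective_iff_injective_and_card]
    exact ⟨fun r r' h => ofBits_injective_boolVec L (congrArg Fin.val h), by simp⟩
  set e : (Fin L → Bool) ≃ Fin (2 ^ L) := Equiv.ofBijective _ hbij with he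
  have hsub : (Matrix.of fun r c : Fin L → Bool =>
      (((liouville (Nat.ofBits (fun j : Fin (2 * L) =>
        Sum.elim r c ((finSumFinEquiv.trans (finCongr (two_mul L).symm)).symm j)) + 1) : ℤ) :
          ℂ))) =
      (Matrix.of fun a b : Fin (2 ^ L) =>
        (((liouville ((a : ℕ) + 2 ^ L * (b : ℕ) + 1) : ℤ) : ℂ))).submatrix e e := by
    ext r c
    simp only [Matrix.submatrix_apply, Matrix.of_apply, he, Equiv.ofBijective_apply]
    rw [ofBits_alignedCut L r c]
  rw [hsub, Matrix.rank_submatrix]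

/-! ### §2 Cuts with an aligned window `R^L C^L` -/

/-- **Window step.**  If positions `s, …, s+L-1` of the cut `π` are row positions and
`s+L, …, s+2L-1` are column positions, then `rank M_π ≥ rank` of the aligned matrix at level `L`
(window embedding `rank_inducedCut_le` with the aligned induced cut, §1). [folklore] -/
theorem rank_aligned_le_rank_of_window (L n : ℕ) (π : Fin n ⊕ Fin n ≃ Fin (2 * n)) (s : ℕ)
    (hs : s + 2 * L ≤ 2 * n)
    (hrow : ∀ j : Fin (2 * n), s ≤ (j : ℕ) → (j : ℕ) < s + L → (π.symm j).isLeft = true)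
    (hcol : ∀ j : Fin (2 * n), s + L ≤ (j : ℕ) → (j : ℕ) < s + 2 * L → (π.symm j).isLeft = false) :
    (Matrix.of fun a b : Fin (2 ^ L) =>
      (((liouville ((a : ℕ) + 2 ^ L * (b : ℕ) + 1) : ℤ) : ℂ))).rank ≤
    (Matrix.of fun r c : Fin n → Bool =>
      (((liouville (Nat.ofBits (fun j : Fin (2 * n) => Sum.elim r c (π.symm j)) + 1) : ℤ) :
        ℂ))).rank := by
  rw [← rank_alignedCut_eq L]
  refine rank_inducedCut_le L n π (fun j => decide (j < s + L)) s hs ?_ _ ?_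
  · intro j h1 h2
    by_cases hj : (j : ℕ) < s + L
    · rw [hrow j h1 hj, decide_eq_true hj]
    · rw [hcol j (not_lt.mp hj) h2, decide_eq_false hj]
  · intro k
    rw [alignedCut_symm_isLeft]
    by_cases hk : (k : ℕ) < L
    · rw [decide_eq_true hk, decide_eq_true (by omega)]
    · rw [decide_eq_false hk, decide_eq_false (by omega)]

/-- **`LiouvilleCutRank` on cuts with an aligned window** (every `W`): for every `W` there is `L`
such that every cut `π` of any level `n` whose row/column word contains `L` consecutive row positions
followed by `L` consecutive column positions has `rank M_π ≥ W` (window step + `AlignedCutRank`,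
i.e. Coons' non-automaticity of `λ`). [folklore] -/
theorem le_rank_of_alignedWindow (W : ℕ) : ∃ L : ℕ, ∀ (n : ℕ) (π : Fin n ⊕ Fin n ≃ Fin (2 * n))
    (s : ℕ), s + 2 * L ≤ 2 * n →
    (∀ j : Fin (2 * n), s ≤ (j : ℕ) → (j : ℕ) < s + L → (π.symm j).isLeft = true) →
    (∀ j : Fin (2 * n), s + L ≤ (j : ℕ) → (j : ℕ) < s + 2 * L → (π.symm j).isLeft = false) →
    W ≤ (Matrix.of fun r c : Fin n → Bool =>
      (((liouville (Nat.ofBits (fun j : Fin (2 * n) => Sum.elim r c (π.symm j)) + 1) : ℤ) :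
        ℂ))).rank := by
  obtain ⟨n₀, hn₀⟩ := alignedCutRank_proof W
  exact ⟨n₀, fun n π s hs hrow hcol =>
    (hn₀ n₀ le_rfl).trans (rank_aligned_le_rank_of_window n₀ n π s hs hrow hcol)⟩

/-! ### §3 Cuts with an anti-aligned window `C^L R^L` -/

/-- **Window step, anti-aligned.**  If positions `s, …, s+L-1` of `π` are column positions and
`s+L, …, s+2L-1` are row positions, then `rank M_π ≥ rank` of the aligned matrix at level `L`: the
induced cut is the aligned cut with rows and columns exchanged (`Equiv.sumComm`), whose matrix is the
transpose. [folklore] -/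
theorem rank_aligned_le_rank_of_antiWindow (L n : ℕ) (π : Fin n ⊕ Fin n ≃ Fin (2 * n)) (s : ℕ)
    (hs : s + 2 * L ≤ 2 * n)
    (hcol : ∀ j : Fin (2 * n), s ≤ (j : ℕ) → (j : ℕ) < s + L → (π.symm j).isLeft = false)
    (hrow : ∀ j : Fin (2 * n), s + L ≤ (j : ℕ) → (j : ℕ) < s + 2 * L → (π.symm j).isLeft = true) :
    (Matrix.of fun a b : Fin (2 ^ L) =>
      (((liouville ((a : ℕ) + 2 ^ L * (b : ℕ) + 1) : ℤ) : ℂ))).rank ≤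
    (Matrix.of fun r c : Fin n → Bool =>
      (((liouville (Nat.ofBits (fun j : Fin (2 * n) => Sum.elim r c (π.symm j)) + 1) : ℤ) :
        ℂ))).rank := by
  set πa : Fin L ⊕ Fin L ≃ Fin (2 * L) := finSumFinEquiv.trans (finCongr (two_mul L).symm) with hπa
  set π₁ : Fin L ⊕ Fin L ≃ Fin (2 * L) := (Equiv.sumComm (Fin L) (Fin L)).trans πa with hπ₁
  -- the induced cut π₁ has the transposed aligned matrix
  have hT : (Matrix.of fun r c : Fin L → Bool =>
      (((liouville (Nat.ofBits (fun j : Fin (2 * L) => Sum.elim r c (π₁.symm j)) + 1) : ℤ) :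
        ℂ))) =
      (Matrix.of fun r c : Fin L → Bool =>
        (((liouville (Nat.ofBits (fun j : Fin (2 * L) => Sum.elim r c (πa.symm j)) + 1) : ℤ) :
          ℂ))).transpose := by
    ext r c
    simp only [Matrix.transpose_apply, Matrix.of_apply]
    have hf : (fun j : Fin (2 * L) => Sum.elim r c (π₁.symm j)) =
        fun j : Fin (2 * L) => Sum.elim c r (πa.symm j) := by
      funext j
      rw [hπ₁, Equiv.symm_trans_apply, Equiv.sumComm_symm, Equiv.sumComm_apply]
      cases πa.symm j <;> rfl
    rw [hf]
  have hrk : (Matrix.of fun a b : Fin (2 ^ L) =>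
      (((liouville ((a : ℕ) + 2 ^ L * (b : ℕ) + 1) : ℤ) : ℂ))).rank =
      (Matrix.of fun r c : Fin L → Bool =>
        (((liouville (Nat.ofBits (fun j : Fin (2 * L) => Sum.elim r c (π₁.symm j)) + 1) : ℤ) :
          ℂ))).rank := by
    rw [hT, Matrix.rank_transpose, hπa, rank_alignedCut_eq]
  rw [hrk]
  refine rank_inducedCut_le L n π (fun j => decide (s + L ≤ j)) s hs ?_ π₁ ?_
  · intro j h1 h2
    by_cases hj : s + L ≤ (j : ℕ)
    · rw [hrow j hj h2, decide_eq_true hj]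
    · rw [hcol j h1 (not_le.mp hj), decide_eq_false hj]
  · intro k
    have hk : (π₁.symm k).isLeft = !(πa.symm k).isLeft := by
      rw [hπ₁, Equiv.symm_trans_apply, Equiv.sumComm_symm, Equiv.sumComm_apply, Sum.isLeft_swap]
      cases πa.symm k <;> rfl
    rw [hk, hπa, alignedCut_symm_isLeft]
    by_cases hkL : (k : ℕ) < L
    · rw [decide_eq_true hkL, decide_eq_false (by omega)]; rfl
    · rw [decide_eq_false hkL, decide_eq_true (by omega)]; rfl

/-- **`LiouvilleCutRank` on cuts with an anti-aligned window** (every `W`): for every `W` there is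
`L` such that every cut whose row/column word contains `L` consecutive column positions followed by
`L` consecutive row positions has `rank M_π ≥ W`. [folklore] -/
theorem le_rank_of_antiAlignedWindow (W : ℕ) : ∃ L : ℕ, ∀ (n : ℕ) (π : Fin n ⊕ Fin n ≃ Fin (2 * n))
    (s : ℕ), s + 2 * L ≤ 2 * n →
    (∀ j : Fin (2 * n), s ≤ (j : ℕ) → (j : ℕ) < s + L → (π.symm j).isLeft = false) →
    (∀ j : Fin (2 * n), s + L ≤ (j : ℕ) → (j : ℕ) < s + 2 * L → (π.symm j).isLeft = true) →
    W ≤ (Matrix.of fun r c : Fin n → Bool =>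
      (((liouville (Nat.ofBits (fun j : Fin (2 * n) => Sum.elim r c (π.symm j)) + 1) : ℤ) :
        ℂ))).rank := by
  obtain ⟨n₀, hn₀⟩ := alignedCutRank_proof W
  exact ⟨n₀, fun n π s hs hcol hrow =>
    (hn₀ n₀ le_rfl).trans (rank_aligned_le_rank_of_antiWindow n₀ n π s hs hcol hrow)⟩

/-- **Both orientations, one `L`.**  For every `W` there is `L` such that every cut containing a
window `R^L C^L` or `C^L R^L` has cut-matrix rank `≥ W`. [folklore] -/
theorem le_rank_of_locallyAlignedWindow (W : ℕ) : ∃ L : ℕ, ∀ (n : ℕ)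
    (π : Fin n ⊕ Fin n ≃ Fin (2 * n)) (s : ℕ), s + 2 * L ≤ 2 * n →
    ((∀ j : Fin (2 * n), s ≤ (j : ℕ) → (j : ℕ) < s + 2 * L →
        (π.symm j).isLeft = decide ((j : ℕ) < s + L)) ∨
     (∀ j : Fin (2 * n), s ≤ (j : ℕ) → (j : ℕ) < s + 2 * L →
        (π.symm j).isLeft = decide (s + L ≤ (j : ℕ)))) →
    W ≤ (Matrix.of fun r c : Fin n → Bool =>
      (((liouville (Nat.ofBits (fun j : Fin (2 * n) => Sum.elim r c (π.symm j)) + 1) : ℤ) :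
        ℂ))).rank := by
  obtain ⟨n₀, hn₀⟩ := alignedCutRank_proof W
  refine ⟨n₀, fun n π s hs h => ?_⟩
  rcases h with h | h
  · refine (hn₀ n₀ le_rfl).trans (rank_aligned_le_rank_of_window n₀ n π s hs ?_ ?_)
    · intro j h1 h2; rw [h j h1 (by omega), decide_eq_true h2]
    · intro j h1 h2; rw [h j (by omega) h2, decide_eq_false (by omega)]
  · refine (hn₀ n₀ le_rfl).trans (rank_aligned_le_rank_of_antiWindow n₀ n π s hs ?_ ?_)
    · intro j h1 h2; rw [h j h1 (by omega), decide_eq_false (by omega)]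
    · intro j h1 h2; rw [h j (by omega) h2, decide_eq_true h1]

end Summit.ValiantsHypothesis.ValiantsHypothesis.Theorems.LiouvilleSarnakCutRankAlignedWindow
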